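import Mathlib
import Literature.Analysis.ODE.InverseSquareLadder
import HarnessLib

/-!
# Locality of the Darboux ladder and the `1/x` decay of its lower-order terms

Analysis/ODE support file (everything proved).
* `ladder_eventuallyEq`: the ladder is a differential operator, so `f = g` near `x` implies
  `ladder ι n f = ladder ι n g` near `x`.
* `abs_ladder_sub_iteratedDeriv_le`: given the expansion
  `ladder ι n u = Σ_{j≤n} β_j ι^{n−j} u^{(j)}` with `β_n = 1` (`InverseSquareLadderExpansion.lean`)
  at a point `z` with `ι z = 1/z`, `z ≥ 1`, the ladder differs from the top derivative by lower-order
  terms of size `1/z`: `|ladder ι n u z − u^{(n)}(z)| ≤ (Σ_{j<n} |β_j| |u^{(j)}(z)|) / z`.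
These two facts drive the large-time asymptotics of the exact inverse-square waves
`ladder ι n Φ(t,·)` in the window `x = y + t` (`y` fixed, `t → ∞`): every lower-order term carries a
factor `1/(y+t)` (route PhotonSphereChannels, `FixedModeChannels`, far side,
stmt-FinalStateConjecture-10048). Folklore.
-/

noncomputable section

namespace Literature.Analysis.ODE

open Set Filter Topology Finset

variable {ι : ℝ → ℝ}

/-- **Locality of one rung**: `f = g` near `x` ⇒ `ladderStep ι k f = ladderStep ι k g` near `x`.
[folklore] -/
theorem ladderStep_eventuallyEq {f g : ℝ → ℝ} {x : ℝ} (h : f =ᶠ[𝓝 x] g) (k : ℕ) :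
    ladderStep ι k f =ᶠ[𝓝 x] ladderStep ι k g := by
  have hd : deriv f =ᶠ[𝓝 x] deriv g := h.deriv
  -- `h` holds on a neighbourhood, hence near every nearby point
  have h' : ∀ᶠ y in 𝓝 x, f =ᶠ[𝓝 y] g := h.eventually_nhds
  filter_upwards [h, h'] with y hy hy'
  rw [ladderStep_apply, ladderStep_apply, hy, hy'.deriv_eq]

/-- **Locality of the ladder**: `f = g` near `x` ⇒ `ladder ι n f = ladder ι n g` near `x`.
[folklore] -/
theorem ladder_eventuallyEq {f g : ℝ → ℝ} {x : ℝ} (h : f =ᶠ[𝓝 x] g) (n : ℕ) :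
    ladder ι n f =ᶠ[𝓝 x] ladder ι n g := by
  induction n with
  | zero => simpa using h
  | succ n ih => rw [ladder_succ, ladder_succ]; exact ladderStep_eventuallyEq ih _

/-- Pointwise form of `ladder_eventuallyEq`. [folklore] -/
theorem ladder_congr_of_eventuallyEq {f g : ℝ → ℝ} {x : ℝ} (h : f =ᶠ[𝓝 x] g) (n : ℕ) :
    ladder ι n f x = ladder ι n g x :=
  (ladder_eventuallyEq h n).eq_of_nhds

/-- **Lower-order terms decay like `1/z`.** If at the point `z` the ladder has the expansion
`ladder ι n u z = Σ_{j≤n} β_j ι(z)^{n−j} u^{(j)}(z)` with `β_n = 1`, `ι z = z⁻¹` and `1 ≤ z`, then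
`|ladder ι n u z − u^{(n)}(z)| ≤ (Σ_{j<n} |β_j| |u^{(j)}(z)|)/z`. [folklore] -/
theorem abs_ladder_sub_iteratedDeriv_le {β : ℕ → ℝ} {n : ℕ} (hβn : β n = 1) {u : ℝ → ℝ}
    {z : ℝ} (hz : 1 ≤ z) (hιz : ι z = z⁻¹)
    (hexp : ladder ι n u z = ∑ j ∈ range (n + 1), β j * ι z ^ (n - j) * iteratedDeriv j u z) :
    |ladder ι n u z - iteratedDeriv n u z|
      ≤ (∑ j ∈ range n, |β j| * |iteratedDeriv j u z|) / z := by
  have hz0 : 0 < z := by linarith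
  rw [hexp, sum_range_succ, hβn, Nat.sub_self, pow_zero, one_mul, one_mul, add_sub_cancel_right,
    sum_div]
  refine (abs_sum_le_sum_abs _ _).trans (sum_le_sum fun j hj => ?_)
  have hjn : j < n := mem_range.1 hj
  rw [abs_mul, abs_mul, hιz, abs_of_nonneg (pow_nonneg (inv_nonneg.2 hz0.le) _)]
  -- `z^{-(n-j)} ≤ z^{-1}`
  have hpow : z⁻¹ ^ (n - j) ≤ z⁻¹ := by
    have h1 : z⁻¹ ≤ 1 := inv_le_one_of_one_le₀ hz
    have h0 : 0 ≤ z⁻¹ := inv_nonneg.2 hz0.le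
    calc z⁻¹ ^ (n - j) = z⁻¹ * z⁻¹ ^ (n - j - 1) := by
          rw [← pow_succ', show n - j - 1 + 1 = n - j by omega]
      _ ≤ z⁻¹ * 1 := mul_le_mul_of_nonneg_left (pow_le_one₀ h0 h1) h0
      _ = z⁻¹ := mul_one _
  calc |β j| * z⁻¹ ^ (n - j) * |iteratedDeriv j u z|
      ≤ |β j| * z⁻¹ * |iteratedDeriv j u z| :=
        mul_le_mul_of_nonneg_right (mul_le_mul_of_nonneg_left hpow (abs_nonneg _)) (abs_nonneg _)
    _ = |β j| * |iteratedDeriv j u z| / z := by rw [div_eq_mul_inv]; ring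

end Literature.Analysis.ODE
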